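import Summits.QuantumAdvantage.QuantumAdvantage.Theorems.SosSandwichTransferPBDefs
import Literature.Computability.Cryptography.QubitRegisterCliffordTProofs

/-!
# Crux `TransferPB` (stmt-QuantumAdvantage-15238, route SosSandwich), line `birth` — stub `stub_oracleAcceptPseudoBounded`

`Q_T ⊆ K_T` FOR ORACLE CIRCUITS. For every Clifford+T oracle circuit family `F` and input `x`, the tree's
acceptance polynomial `acceptPoly F x` (in the `numOracleBits F x` relevant oracle bits) is PSEUDO-BOUNDED OF
ORDER `#oracle gates` (`PseudoBounded (F.circ |x|).oracleQueries (acceptPoly F x)`): on the cube,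
`p = Σ_{y accepted} (Re amp_y)² + (Im amp_y)²` and `1 − p = Σ_{y rejected} (Re amp_y)² + (Im amp_y)²`, where every
final amplitude `amp_y(A) = (U_C^A |x 0^m⟩)(y)` is `P_y + i·Q_y` at the `0/1` point of the oracle `A`, with REAL
polynomials `P_y, Q_y` of total degree `≤ #oracle gates` (Beals–Buhrman–Cleve–Mosca–de Wolf Lemma 4.1 for
oracle circuits, tree `ohasDegreeLE_toMatrix_mulVec`), and `Σ_y ‖amp_y‖² = 1` because Clifford+T is unitary
(tree `QCircuit.normSq_runOn_basisState`, `cliffordT_isUnitary_holds`). The certificate over the oracle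
variables `OracleVar (|x| + ancillas)` (`exists_sos_acceptProb`) is transported to `Fin (numOracleBits F x)`
along the enumeration `bitEquiv F x` (`rename`; degrees do not increase), every cube point being the bit
pattern of some oracle (`oracleBits_oracleOf`). The oracle-circuit twin of the route's support item
`QueryAcceptPseudoBounded` (stmt-QuantumAdvantage-15242, `Theorems/SosSandwichQueryAcceptPseudoBounded.lean`).

Registered signature `Sig.stub_oracleAcceptPseudoBounded` (skeleton `Cruxes/TransferPB/Lines/birth.lean`, sha
da18b1e6f9e760f8…), imported from `Theorems/SosSandwichTransferPBDefs.lean` (same namespace).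
-/

-- D-0017: single-conjunct summit ⇒ the duplicate `QuantumAdvantage.QuantumAdvantage` is mandated.
set_option linter.dupNamespace false

noncomputable section

namespace Summit.QuantumAdvantage.QuantumAdvantage.Cruxes.TransferPB.Birth

open Matrix Finset MvPolynomial Literature.Computability.Complexity Literature.Computability.Cryptography
  Literature.Computability.QuantumComplexity

namespace StubOracleAcceptPseudoBounded

/-- **Beals et al. Lemma 4.1 + unitarity for one oracle circuit** over a unitary gate set: there are real
polynomials `q_j, r_j` in the oracle bits of the strings of length `< n + m`, of total degree
`≤ #oracle gates of C`, with `Pr[C^A(x 0^m) accepts] = Σ_j q_j(A)²` and `1 − Pr[…] = Σ_j r_j(A)²` for EVERY oracle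
`A` (real and imaginary parts of the accepted, resp. rejected, final amplitudes).
[cite: BealsEtAl2001, Lemma 4.1 and Lemma 4.2] [cite: KaniewskiLeeDewolf2015, Thm. 12] -/
theorem exists_sos_acceptProb {G : QGateSet} (hG : G.IsUnitary) {n m : ℕ} (C : QCircuit G (n + m))
    (x : QReg n) :
    ∃ (k : ℕ) (q r : Fin k → MvPolynomial (OracleVar (n + m)) ℝ),
      (∀ j, (q j).totalDegree ≤ C.oracleQueries ∧ (r j).totalDegree ≤ C.oracleQueries) ∧
      ∀ A : Language Bool,
        C.acceptProb A x = ∑ j, MvPolynomial.eval (oraclePt (n + m) A) (q j) ^ 2 ∧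
        1 - C.acceptProb A x = ∑ j, MvPolynomial.eval (oraclePt (n + m) A) (r j) ^ 2 := by
  classical
  -- amplitudes are complex polynomials of degree `≤ #oracle gates` in the oracle bits
  have hamp : ∀ y : QReg (n + m), OHasDegreeLE (n + m) C.oracleQueries
      fun A => (C.toMatrix A *ᵥ basisState (padInput x m)) y := by
    intro y
    have h := ohasDegreeLE_toMatrix_mulVec C.gates (d := 0) (ψ := fun _ => basisState (padInput x m))
      (fun s => OHasDegreeLE.const 0 _) y
    simpa using h
  choose P Q hP hQ h using hamp
  beta_reduce at h
  -- squared moduli of the amplitudes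
  have hnorm : ∀ (A : Language Bool) (y : QReg (n + m)),
      ‖(C.runOn A (basisState (padInput x m))) y‖ ^ 2 =
        MvPolynomial.eval (oraclePt (n + m) A) (P y) ^ 2 +
          MvPolynomial.eval (oraclePt (n + m) A) (Q y) ^ 2 := by
    intro A y
    rw [QCircuit.runOn, h y A, Complex.sq_norm, Complex.normSq_apply]
    simp only [Complex.add_re, Complex.add_im, Complex.mul_re, Complex.mul_im, Complex.ofReal_re,
      Complex.ofReal_im, Complex.I_re, Complex.I_im, mul_zero, mul_one, sub_zero, zero_add, add_zero]
    ring
  -- the output state is a unit vector (unitary gate set)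
  have hone : ∀ A : Language Bool,
      ∑ y : QReg (n + m), ‖(C.runOn A (basisState (padInput x m))) y‖ ^ 2 = 1 := by
    intro A
    have h1 := QCircuit.normSq_runOn_basisState hG A C x
    simp only [normSq] at h1
    exact h1
  by_cases hN : 0 < n + m
  · -- index the certificates by (basis state, real/imaginary part)
    set ι := QReg (n + m) × Bool with hι
    set e : ι ≃ Fin (Fintype.card ι) := Fintype.equivFin ι with he
    set qf : ι → MvPolynomial (OracleVar (n + m)) ℝ :=
      fun yb => if yb.1 ⟨0, hN⟩ = true then (if yb.2 = true then P yb.1 else Q yb.1) else 0 with hqf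
    set rf : ι → MvPolynomial (OracleVar (n + m)) ℝ :=
      fun yb => if yb.1 ⟨0, hN⟩ = true then 0 else (if yb.2 = true then P yb.1 else Q yb.1) with hrf
    refine ⟨Fintype.card ι, fun j => qf (e.symm j), fun j => rf (e.symm j), fun j => ⟨?_, ?_⟩,
      fun A => ⟨?_, ?_⟩⟩
    · simp only [hqf]
      split_ifs
      · exact hP _
      · exact hQ _
      · simp
    · simp only [hrf]
      split_ifs
      · simp
      · exact hP _
      · exact hQ _
    · rw [Equiv.sum_comp e.symm (fun yb => MvPolynomial.eval (oraclePt (n + m) A) (qf yb) ^ 2),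
        Fintype.sum_prod_type]
      simp only [Fintype.sum_bool]
      unfold QCircuit.acceptProb
      refine Finset.sum_congr rfl fun y _ => ?_
      rw [dif_pos hN]
      by_cases hy : y ⟨0, hN⟩ = true
      · rw [if_pos hy, hnorm A y]
        simp [hqf, hy]
      · rw [if_neg hy]
        simp [hqf, hy]
    · rw [← hone A, Equiv.sum_comp e.symm (fun yb => MvPolynomial.eval (oraclePt (n + m) A) (rf yb) ^ 2),
        Fintype.sum_prod_type]
      simp only [Fintype.sum_bool]
      unfold QCircuit.acceptProb
      rw [← Finset.sum_sub_distrib]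
      refine Finset.sum_congr rfl fun y _ => ?_
      rw [dif_pos hN]
      by_cases hy : y ⟨0, hN⟩ = true
      · rw [if_pos hy]
        simp [hrf, hy]
      · rw [if_neg hy, hnorm A y]
        simp [hrf, hy]
  · -- the empty register: acceptance probability `0`, certificates `0 = Σ∅`, `1 = 1²`
    have h0 : ∀ A : Language Bool, C.acceptProb A x = 0 := fun A => by
      unfold QCircuit.acceptProb
      simp [hN]
    refine ⟨1, fun _ => 0, fun _ => 1, fun _ => ⟨by simp, by simp⟩, fun A => ⟨?_, ?_⟩⟩
    · simp [h0 A]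
    · simp [h0 A]

/-- Transport along the enumeration of the oracle variables: the value at the relevant bits of `A` of a
polynomial renamed along `bitEquiv F x` is its value at the `0/1` point of `A` (the computation behind the
tree's `evalBool_acceptPoly`). [folklore] -/
theorem evalBool_rename_bitEquiv {G : QGateSet} (F : QCircuitFamily G) (x : List Bool)
    (R : MvPolynomial (OracleVar (oracleWidth F x)) ℝ) (A : Set (List Bool)) :
    evalBool (MvPolynomial.rename (bitEquiv F x) R) (oracleBits F x A) =
      MvPolynomial.eval (oraclePt (oracleWidth F x) A) R := by
  unfold evalBool
  rw [MvPolynomial.eval_rename, oraclePt_eq_restrictBool]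
  exact congrArg (fun g => MvPolynomial.eval g R) (funext fun q => by simp [oracleBits])

end StubOracleAcceptPseudoBounded

open StubOracleAcceptPseudoBounded in
/-- **Stub `stub_oracleAcceptPseudoBounded` of line `birth`** (registered signature
`Sig.stub_oracleAcceptPseudoBounded`): for every Clifford+T oracle circuit family `F` and input `x`, the
acceptance polynomial `acceptPoly F x` is pseudo-bounded of order `(F.circ |x|).oracleQueries` — `p` and `1 − p`
are, on the cube `{0,1}^{numOracleBits F x}`, sums of squares of polynomials of total degree `≤ #oracle gates`
(Beals et al. Lemma 4.1 for oracle circuits + unitarity of Clifford+T, transported along `bitEquiv F x`; every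
cube point is the bit pattern of the oracle `oracleOf F x b`).
[cite: BealsEtAl2001, Lemma 4.1] [cite: AaronsonAmbainis2014, Lemma 20] [cite: KaniewskiLeeDewolf2015, Thm. 12] -/
theorem stub_oracleAcceptPseudoBounded : Sig.stub_oracleAcceptPseudoBounded := by
  intro F x
  classical
  obtain ⟨k, q, r, hdeg, hval⟩ :=
    exists_sos_acceptProb cliffordT_isUnitary_holds (F.circ x.length) x.get
  refine ⟨k, fun j => MvPolynomial.rename (bitEquiv F x) (q j),
    fun j => MvPolynomial.rename (bitEquiv F x) (r j), fun j => ⟨?_, ?_⟩, fun b => ?_⟩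
  · exact (MvPolynomial.totalDegree_rename_le _ _).trans (hdeg j).1
  · exact (MvPolynomial.totalDegree_rename_le _ _).trans (hdeg j).2
  · -- every cube point is the bit pattern of an oracle
    obtain ⟨h1, h2⟩ := hval (oracleOf F x b)
    have hp : MvPolynomial.eval (fun k => if b k then (1 : ℝ) else 0) (acceptPoly F x) =
        (F.circ x.length).acceptProb (oracleOf F x b) x.get := by
      have h := evalBool_acceptPoly F x (oracleOf F x b)
      rw [oracleBits_oracleOf] at h
      exact h
    have hq : ∀ R : MvPolynomial (OracleVar (oracleWidth F x)) ℝ,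
        MvPolynomial.eval (fun k => if b k then (1 : ℝ) else 0) (MvPolynomial.rename (bitEquiv F x) R) =
          MvPolynomial.eval (oraclePt (oracleWidth F x) (oracleOf F x b)) R := by
      intro R
      have h := evalBool_rename_bitEquiv F x R (oracleOf F x b)
      rw [oracleBits_oracleOf] at h
      exact h
    refine ⟨?_, ?_⟩
    · rw [hp, h1]
      exact Finset.sum_congr rfl fun j _ => by rw [hq]
    · rw [hp, h2]
      exact Finset.sum_congr rfl fun j _ => by rw [hq]

end Summit.QuantumAdvantage.QuantumAdvantage.Cruxes.TransferPB.Birth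

end
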